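import Summits.AtomisticToContinuum.BoseEinsteinCondensation.Theorems.BECGroundStateSOSBoundaryTransferWeakModeFreeRewardSplit
import Summits.AtomisticToContinuum.BoseEinsteinCondensation.Theses.BECHusimiAmplitudeGas

/-!
# Glue of the mode-free reward split of `BoundaryTransferWeak` on route `BECHusimiAmplitudeGas`

Closes the glue item stmt-AtomisticToContinuum-18445
`Summit.AtomisticToContinuum.BoseEinsteinCondensation.Theses.BECHusimiAmplitudeGas.BoundaryTransferWeakGlue`
(`ModeFreeRewardChord → ModeFreeSlopeToBEC → BoundaryTransferWeak`, split D11 filed 2026-08-17T16:07Z by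
crux-strategist s2, route file rev 3) BY NAME, from the landed assembly
`ModeFreeReward.boundaryTransferWeak_of_modeFreeReward` (p164138; the two hypotheses are verbatim the bodies
of the child items stmt-18443 `ModeFreeRewardChord` and stmt-18444 `ModeFreeSlopeToBEC`, and the route copies
of the shared crux are definitionally equal).
-/

namespace Summit.AtomisticToContinuum.BoseEinsteinCondensation.ModeFreeReward

/-- **Glue item stmt-AtomisticToContinuum-18445** (`BECHusimiAmplitudeGas.BoundaryTransferWeakGlue`):
the filed split `ModeFreeRewardChord → ModeFreeSlopeToBEC → BoundaryTransferWeak` is exactly the landed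
assembly `boundaryTransferWeak_of_modeFreeReward`. [folklore] -/
theorem boundaryTransferWeakGlue_husimi :
    Summit.AtomisticToContinuum.BoseEinsteinCondensation.Theses.BECHusimiAmplitudeGas.BoundaryTransferWeakGlue :=
  fun h₁ h₂ => boundaryTransferWeak_of_modeFreeReward h₁ h₂

example :
    Summit.AtomisticToContinuum.BoseEinsteinCondensation.Theses.BECHusimiAmplitudeGas.BoundaryTransferWeak =
      Summit.AtomisticToContinuum.BoseEinsteinCondensation.Theses.BECPeriodicReduction.BoundaryTransferWeak :=
  rfl

end Summit.AtomisticToContinuum.BoseEinsteinCondensation.ModeFreeReward
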